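import Summits.CriticalPhenomena.PercolationContinuityZ3.Theorems.PercNearOneGluingNoHeavyLowerTailSahiE3ProductSections
import Summits.CriticalPhenomena.PercolationContinuityZ3.Theorems.PercNearOneGluingNoHeavyLowerTailSahiC3CubeFunctions
import Literature.Probability.LatticeModels.SahiThirdOrderCorrelation
import Mathlib.Tactic.Linarith
import Mathlib.Tactic.Ring
import HarnessLib
import HarnessLib.Audit

/-!
# `NoHeavyLowerTail` (crux stmt-CriticalPhenomena-4575), Sahi programme P4: the TENSORISATION IDENTITY for Sahi's `E₃`
# over a product of two independent blocks

Support file (cell `prim-l12`, seat P4, generation 31; `--supports stmt-CriticalPhenomena-4575`).  No named facts, no sorries;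
standard axioms; def-free.

For a product probability weight `w(b,t) = ν_B(b)·ν_Q(t)` (`Σ ν_B = Σ ν_Q = 1`) on `B × Q` and ANY three finite sets `U, A, C ⊆ B × Q`
with `Q`-sections `U_b = {t | (b,t) ∈ U}` (section masses `u_b = ν_Q(U_b)`, …, fibre covariances
`κ^{AC}_b = ν_Q(A_b ∩ C_b) − a_b c_b`, …), Sahi's third functional splits EXACTLY as
  `latticeE3 w U A C = Σ_b ν_B(b)·latticeE3 ν_Q U_b A_b C_b`                      (fibre term)
  `                  + latticeE3fun ν_B u a c`                                       (Sahi's functional of the section-mass FUNCTIONS on the base)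
  `                  + Cov_B(u, κ^{AC}) + Cov_B(a, κ^{UC}) + Cov_B(c, κ^{UA})`        (cross terms),
`Cov_B(f,g) = Σ_b ν_B f g − (Σ ν_B f)(Σ ν_B g)` — theorem `latticeE3_tensor`.  For up-sets under FKG/product fibres the first two
terms are instances of `C₃` (on the fibre, and on the base for [0,1]-valued monotone functions) while the cross terms carry no sign:
this is the exact obstruction to proving Kahn's Conjecture 5 by induction on independent blocks (HOME prim-l12-p4 memos gen 30
ADDENDUM R8, gen 31 R8: for the 2-clause read-once CNF slot the cross term is negative in 392/1 500 random instances).  Pure algebra: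
masses over `B × Q` are iterated section sums (`…SahiE3ProductSections.sum_sectionsQ`). [this work]
-/

namespace Summit.CriticalPhenomena.PercolationContinuityZ3.Theorems.SahiE3Tensor

open Finset Literature.Probability.LatticeModels SahiE3ProductSections SahiC3Cube
open scoped BigOperators

variable {B Q : Type*} [Fintype B] [DecidableEq B] [Fintype Q] [DecidableEq Q]

/-- Mass of a subset of `B × Q` under a product weight = `Σ_b ν_B(b) · ν_Q(Q-section at b)`. [folklore] -/
theorem mass_prod_eq_sum_sections (νB : B → ℝ) (νQ : Q → ℝ) (w : B × Q → ℝ) (hw : ∀ x, w x = νB x.1 * νQ x.2)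
    (X : Finset (B × Q)) :
    mass w X = ∑ b, νB b * mass νQ (univ.filter fun t => (b, t) ∈ X) := by
  unfold mass
  rw [sum_sectionsQ X w]
  refine Finset.sum_congr rfl fun b _ => ?_
  rw [Finset.mul_sum]
  exact Finset.sum_congr rfl fun t _ => hw (b, t)

/-- Total mass of a product of two probability weights is `1`. [folklore] -/
theorem mass_prod_univ (νB : B → ℝ) (νQ : Q → ℝ) (hB1 : ∑ b, νB b = 1) (hQ1 : ∑ t, νQ t = 1) (w : B × Q → ℝ)
    (hw : ∀ x, w x = νB x.1 * νQ x.2) : mass w univ = 1 := by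
  rw [mass_prod_eq_sum_sections νB νQ w hw]
  have : ∀ b : B, (univ.filter fun t : Q => (b, t) ∈ (univ : Finset (B × Q))) = univ := fun b => by ext t; simp
  simp_rw [this]
  unfold mass
  rw [hQ1]; simp [hB1]

/-- **Tensorisation of Sahi's `E₃` over two independent blocks** (see the module docstring). [this work] -/
theorem latticeE3_tensor (νB : B → ℝ) (νQ : Q → ℝ) (hB1 : ∑ b, νB b = 1) (hQ1 : ∑ t, νQ t = 1)
    (w : B × Q → ℝ) (hw : ∀ x, w x = νB x.1 * νQ x.2) (U A C : Finset (B × Q)) :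
    latticeE3 w U A C =
      (∑ b, νB b * latticeE3 νQ (univ.filter fun t => (b, t) ∈ U) (univ.filter fun t => (b, t) ∈ A)
          (univ.filter fun t => (b, t) ∈ C))
      + latticeE3fun νB (fun b => mass νQ (univ.filter fun t => (b, t) ∈ U))
          (fun b => mass νQ (univ.filter fun t => (b, t) ∈ A)) (fun b => mass νQ (univ.filter fun t => (b, t) ∈ C))
      + ((∑ b, νB b * (mass νQ (univ.filter fun t => (b, t) ∈ U) *
              (mass νQ ((univ.filter fun t => (b, t) ∈ A) ∩ (univ.filter fun t => (b, t) ∈ C))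
                - mass νQ (univ.filter fun t => (b, t) ∈ A) * mass νQ (univ.filter fun t => (b, t) ∈ C))))
          - (∑ b, νB b * mass νQ (univ.filter fun t => (b, t) ∈ U)) *
            (∑ b, νB b * (mass νQ ((univ.filter fun t => (b, t) ∈ A) ∩ (univ.filter fun t => (b, t) ∈ C))
                - mass νQ (univ.filter fun t => (b, t) ∈ A) * mass νQ (univ.filter fun t => (b, t) ∈ C))))
      + ((∑ b, νB b * (mass νQ (univ.filter fun t => (b, t) ∈ A) *
              (mass νQ ((univ.filter fun t => (b, t) ∈ U) ∩ (univ.filter fun t => (b, t) ∈ C))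
                - mass νQ (univ.filter fun t => (b, t) ∈ U) * mass νQ (univ.filter fun t => (b, t) ∈ C))))
          - (∑ b, νB b * mass νQ (univ.filter fun t => (b, t) ∈ A)) *
            (∑ b, νB b * (mass νQ ((univ.filter fun t => (b, t) ∈ U) ∩ (univ.filter fun t => (b, t) ∈ C))
                - mass νQ (univ.filter fun t => (b, t) ∈ U) * mass νQ (univ.filter fun t => (b, t) ∈ C))))
      + ((∑ b, νB b * (mass νQ (univ.filter fun t => (b, t) ∈ C) *
              (mass νQ ((univ.filter fun t => (b, t) ∈ U) ∩ (univ.filter fun t => (b, t) ∈ A))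
                - mass νQ (univ.filter fun t => (b, t) ∈ U) * mass νQ (univ.filter fun t => (b, t) ∈ A))))
          - (∑ b, νB b * mass νQ (univ.filter fun t => (b, t) ∈ C)) *
            (∑ b, νB b * (mass νQ ((univ.filter fun t => (b, t) ∈ U) ∩ (univ.filter fun t => (b, t) ∈ A))
                - mass νQ (univ.filter fun t => (b, t) ∈ U) * mass νQ (univ.filter fun t => (b, t) ∈ A)))) := by
  -- abbreviations for the section masses
  set u : B → ℝ := fun b => mass νQ (univ.filter fun t => (b, t) ∈ U) with hu
  set a : B → ℝ := fun b => mass νQ (univ.filter fun t => (b, t) ∈ A) with ha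
  set c : B → ℝ := fun b => mass νQ (univ.filter fun t => (b, t) ∈ C) with hc
  set uac : B → ℝ := fun b => mass νQ (univ.filter fun t => (b, t) ∈ U ∩ A ∩ C) with huac
  set ua : B → ℝ := fun b => mass νQ (univ.filter fun t => (b, t) ∈ U ∩ A) with hua
  set uc : B → ℝ := fun b => mass νQ (univ.filter fun t => (b, t) ∈ U ∩ C) with huc
  set ac : B → ℝ := fun b => mass νQ (univ.filter fun t => (b, t) ∈ A ∩ C) with hac
  -- sections of intersections
  have sUA : ∀ b, (univ.filter fun t => (b, t) ∈ U) ∩ (univ.filter fun t => (b, t) ∈ A) = univ.filter fun t => (b, t) ∈ U ∩ A :=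
    fun b => (secQ_inter U A b).symm
  have sUC : ∀ b, (univ.filter fun t => (b, t) ∈ U) ∩ (univ.filter fun t => (b, t) ∈ C) = univ.filter fun t => (b, t) ∈ U ∩ C :=
    fun b => (secQ_inter U C b).symm
  have sAC : ∀ b, (univ.filter fun t => (b, t) ∈ A) ∩ (univ.filter fun t => (b, t) ∈ C) = univ.filter fun t => (b, t) ∈ A ∩ C :=
    fun b => (secQ_inter A C b).symm
  have sUAC : ∀ b, (univ.filter fun t => (b, t) ∈ U) ∩ (univ.filter fun t => (b, t) ∈ A) ∩ (univ.filter fun t => (b, t) ∈ C)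
      = univ.filter fun t => (b, t) ∈ U ∩ A ∩ C := fun b => by rw [sUA, ← secQ_inter]
  -- masses over the product as section sums
  have mZ := mass_prod_univ νB νQ hB1 hQ1 w hw
  have mU : mass w U = ∑ b, νB b * u b := mass_prod_eq_sum_sections νB νQ w hw U
  have mA : mass w A = ∑ b, νB b * a b := mass_prod_eq_sum_sections νB νQ w hw A
  have mC : mass w C = ∑ b, νB b * c b := mass_prod_eq_sum_sections νB νQ w hw C
  have mUA : mass w (U ∩ A) = ∑ b, νB b * ua b := mass_prod_eq_sum_sections νB νQ w hw (U ∩ A)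
  have mUC : mass w (U ∩ C) = ∑ b, νB b * uc b := mass_prod_eq_sum_sections νB νQ w hw (U ∩ C)
  have mAC : mass w (A ∩ C) = ∑ b, νB b * ac b := mass_prod_eq_sum_sections νB νQ w hw (A ∩ C)
  have mUAC : mass w (U ∩ A ∩ C) = ∑ b, νB b * uac b := mass_prod_eq_sum_sections νB νQ w hw (U ∩ A ∩ C)
  have mQ1 : mass νQ univ = 1 := by rw [mass_univ]; exact hQ1
  -- the fibre term, expanded into section-mass sums
  have fib : (∑ b, νB b * latticeE3 νQ (univ.filter fun t => (b, t) ∈ U) (univ.filter fun t => (b, t) ∈ A)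
        (univ.filter fun t => (b, t) ∈ C)) =
      2 * (∑ b, νB b * uac b) + (∑ b, νB b * (u b * a b * c b))
        - (∑ b, νB b * (u b * ac b)) - (∑ b, νB b * (a b * uc b)) - (∑ b, νB b * (c b * ua b)) := by
    have pt : ∀ b, νB b * latticeE3 νQ (univ.filter fun t => (b, t) ∈ U) (univ.filter fun t => (b, t) ∈ A)
        (univ.filter fun t => (b, t) ∈ C) =
        2 * (νB b * uac b) + νB b * (u b * a b * c b) - νB b * (u b * ac b) - νB b * (a b * uc b) - νB b * (c b * ua b) := by
      intro b
      unfold latticeE3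
      rw [mQ1, sUAC, sAC, sUC, sUA]
      simp only [hu, ha, hc, huac, hua, huc, hac]
      ring
    rw [Finset.sum_congr rfl (fun b _ => pt b)]
    simp only [Finset.sum_sub_distrib, Finset.sum_add_distrib, ← Finset.mul_sum]
  -- the base term
  have base : latticeE3fun νB u a c =
      2 * (∑ b, νB b * (u b * a b * c b)) + (∑ b, νB b * u b) * (∑ b, νB b * a b) * (∑ b, νB b * c b)
        - ((∑ b, νB b * u b) * (∑ b, νB b * (a b * c b)) + (∑ b, νB b * a b) * (∑ b, νB b * (u b * c b))
            + (∑ b, νB b * c b) * (∑ b, νB b * (u b * a b))) := by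
    unfold latticeE3fun; rw [hB1]; ring
  -- cross terms expanded
  have cr1 : (∑ b, νB b * (u b * (ac b - a b * c b))) = (∑ b, νB b * (u b * ac b)) - ∑ b, νB b * (u b * a b * c b) := by
    rw [← Finset.sum_sub_distrib]; exact Finset.sum_congr rfl fun b _ => by ring
  have cr1' : (∑ b, νB b * (ac b - a b * c b)) = (∑ b, νB b * ac b) - ∑ b, νB b * (a b * c b) := by
    rw [← Finset.sum_sub_distrib]; exact Finset.sum_congr rfl fun b _ => by ring
  have cr2 : (∑ b, νB b * (a b * (uc b - u b * c b))) = (∑ b, νB b * (a b * uc b)) - ∑ b, νB b * (u b * a b * c b) := by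
    rw [← Finset.sum_sub_distrib]; exact Finset.sum_congr rfl fun b _ => by ring
  have cr2' : (∑ b, νB b * (uc b - u b * c b)) = (∑ b, νB b * uc b) - ∑ b, νB b * (u b * c b) := by
    rw [← Finset.sum_sub_distrib]; exact Finset.sum_congr rfl fun b _ => by ring
  have cr3 : (∑ b, νB b * (c b * (ua b - u b * a b))) = (∑ b, νB b * (c b * ua b)) - ∑ b, νB b * (u b * a b * c b) := by
    rw [← Finset.sum_sub_distrib]; exact Finset.sum_congr rfl fun b _ => by ring
  have cr3' : (∑ b, νB b * (ua b - u b * a b)) = (∑ b, νB b * ua b) - ∑ b, νB b * (u b * a b) := by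
    rw [← Finset.sum_sub_distrib]; exact Finset.sum_congr rfl fun b _ => by ring
  -- assemble
  simp only [sAC, sUC, sUA]
  change latticeE3 w U A C = _ + latticeE3fun νB u a c
      + ((∑ b, νB b * (u b * (ac b - a b * c b))) - (∑ b, νB b * u b) * (∑ b, νB b * (ac b - a b * c b)))
      + ((∑ b, νB b * (a b * (uc b - u b * c b))) - (∑ b, νB b * a b) * (∑ b, νB b * (uc b - u b * c b)))
      + ((∑ b, νB b * (c b * (ua b - u b * a b))) - (∑ b, νB b * c b) * (∑ b, νB b * (ua b - u b * a b)))
  rw [fib, base, cr1, cr1', cr2, cr2', cr3, cr3']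
  unfold latticeE3
  rw [mZ, mU, mA, mC, mUA, mUC, mAC, mUAC]
  ring

end Summit.CriticalPhenomena.PercolationContinuityZ3.Theorems.SahiE3Tensor
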